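import Summits.ABC.IUTFork.Repair.RHWithinPlaceFinancingBarrierJunction
import Summits.ABC.IUTFork.Repair.RHReqsideShellProfile
import Mathlib.Algebra.Order.Archimedean.Basic
import HarnessLib

/-!
# R-H ROUND 4, row R4-6 (iii) — ORBIT OF A DATUM UNDER AN ISOGENY / KUMMER TOWER (height moves, conductor fixed):
# the orbit is a (possibly NON-UNIFORM) dilation of the local heights; every certified class stays under its m-free cap at every
# orbit point; the uniform tower IS the height ray; the field-tower (root-extraction) reading is a pure rescaling (fraction invariant)

PROOF-ONLY file (0 definitions, 0 `Prop` facts, no instance, no notation) of the abc-iut cell (rung LADDER-ABC:A2.RESCUE.H); seat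
abc-iut-rh2-q2-cond (gen 13), KEY `wake/KEY-abc-iut-rh2-q2-cond-R4OBJ-TOWER.md` (ROUND-4 OPENINGS-CENSUS row O-08 «iteration along isogeny /
Kummer towers», HUMAN D-0134 R4-6: «type and compute the h-exponent for object classes NOT in the six typed classes»). TAKES NO SIDE on
[IUTchIII] Cor. 3.12 or on any author; nothing here asserts abc; every statement is integer / elementary real arithmetic about OUR typed exact
cell `RH.DiffPricedHull.HullCellδ e m j δ r_in r_out` and abc-iut-rh2-w-2's claim-tagged barrier frame (`RHHeightScalingBarrier`: `ClosedBy`,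
`NeverClosedFrom`, `barrierScale`), reached only through this seat's junction `RHWithinPlaceFinancingBarrierJunction` (p534933) and law
`RHWithinPlaceFinancingHeightLaw` (p532255) / cap `…HeightCap` (p532824), and abc-iut-rh3-gen-5's `ReqsideShellProfile.hullCellδ_scale` — BY NAME.

THE CLASS IN CELL CURRENCY (memo `plan/rescue/R-H/ROUND4/R4-6-TOWER-rh2-q2-cond.md` §1; the arithmetic dictionary there is a claim-tagged
MODELLING HYPOTHESIS with print loci, not a Literature fact): an isogeny `E → E'` of degree prime to `l` identifies `E[l] ≅ E'[l]`, so
`K = F(√−1, E[l])`, its places `w`, and the place integers `e_w, δ_w, r_in(w), r_out(w), l⋆` are UNCHANGED, and the conductor is an isogeny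
invariant [Silverman1994, IV Ex. 4.40 p. 380]; at a split-multiplicative place the Tate parameter moves by `q ↦ q^N` (kernel `μ_N`, «N-th power
morphism» of a Kummer tower, [IUTchIII] Rmk. 2.1.1 (ii) p. 62) or `q ↦ ζ·q^{1/N}` (étale kernel) [Silverman1994, V Ex. 5.10, 5.15 pp. 452–453],
i.e. the local height moves PLACE BY PLACE: `m_q(w) ↦ t_w·m_q(w)`, `t_w = N^{c_w}`. So an ORBIT POINT is a vector of heights `t_w·m_w` at FIXED
places — a dilation that need not be uniform; the D2 ray of record (`m_w ↦ s·m_w`, AXIS-D2-EXPONENT-TABLE v2.2) is the uniform case.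

WHAT IS PROVED (namespace `Summit.ABC.IUTFork.Repair.RH.TowerOrbit`; cell currency spelled out as in p532255/p534933: slack
`s_j(m) = price_j(m) − d_j(m)`, `price_j(m) = jδ + (j+1)G + ((j²m − jδ − (j+1)r_in) mod e)`, `d_j(m) = (j²−1)m`, cap `C_Π = Σ_{j ≤ L}(jδ + (j+1)G + e − 1)`):
* §1 DIRECTION-FREE CAP (finitely many places `i : Fin k`, weights `c_i ≥ 0`, ANY multipliers `t_i ≥ 0`): `towerOrbit_credit_le_cap`
  (`Σ_i c_i·Σ_{j ≤ J_i} s_j^{(i)}(t_i·m_i) ≤ Σ_i c_i·C_Π(i)` — the cap does not see the direction), `towerOrbit_credit_add_tol_lt_mass_of_lt`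
  (beyond `Σ c_i C_Π(i) + tol < Σ c_i·M_i(t_i m_i)` the class plus the tolerance is short of the orbit point's OWN mass: exponent `−1` in the
  orbit's own height, same constant as the ray); in the barrier's words, for height-indexed multipliers `t_i(s)`: `towerOrbit_family_not_closedBy`,
  `towerOrbit_family_neverClosedFrom` (p534933 `withinPlaceFinancing_family_not_closedBy` / `…neverClosedFrom` BY NAME).
* §2 THE UNIFORM TOWER IS A SUB-RAY: `uniformTower_credit_add_tol_lt_demand_of_lt` (p534933 §3 at `s = N^a`) and
  `uniformTower_eventually_short` (`N ≥ 2`, positive demand slope ⇒ from some floor `a₀` on EVERY floor is short: the tower is cofinal in the ray,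
  `pow_unbounded_of_one_lt`) — «KILLED-BY-CONSISTENCY»: the orbit reproduces the ray's law with the ray's constants.
* §3 EXACT LAW AT AN ORBIT POINT ABOVE ONSET: `towerOrbit_financedMass_bracket` (every place above its financing-collapse height
  `3m′ > 3δ + 5G + 2(e−1)` ⇒ `Σ c_i(δ_i+2G_i) ≤ Σ c_i·min(C_σ,R)_i ≤ Σ c_i(δ_i+2G_i+e_i−1)`, two m′-FREE constants: exponent `−1` EXACTLY in the
  orbit height whatever the direction) and `muTower_eventually_above_onset` (a μ-type tower `m ↦ N^a·m`, `N ≥ 2`, `m ≥ 1`, passes every onset).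
* §4 THE FIELD-TOWER (ROOT-EXTRACTION) READING IS A RESCALING, NOT A HEIGHT MOVE: going up a totally ramified tower of degree `λ` at `w` multiplies
  `e, m, δ, r_in, r_out` by `λ` (tame different: `δ ↦ λδ + (λ−1)`); the cell is INVARIANT (`ReqsideShellProfile.hullCellδ_scale` BY NAME), the slack,
  the demand and the financed mass all scale by `λ` exactly (`cellSlack_scale`, `sum_cellSlack_scale`, `financedMass_scale`), so every recovered
  FRACTION is unchanged (exponent `0` in `λ` — but `λ` is a DEGREE, the curve's height is fixed: census row O-06, not O-08); the different's
  `(λ−1)` bonus only raises slacks, by an m-free amount (`cellSlack_mono_delta`).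
* §5 WORKED ORBIT X1 (FREY `p = 7 ∣ c`, `l = 107`: `e = 1605`, `m = 210`, `δ = 1604`, `r_in = 268`, `r_out = −4472`, `L = 53`; the Frey curve's three
  rational 2-isogenies double `ord(q)` at the places over `c` and halve it over `a, b` — kernel `(0,0)` of `y² = x(x−a)(x+b)` — or symmetrically):
  `row_frey7_l107_isog2_halved` (`m = 105`: ALL 53 labels licensed, on-slice credit `4 022 653 ≤ C_Π = 9 414 496`, place mass `5 353 530` — the
  halved point is content-free at this place), `row_frey7_l107_isog2_doubled` (`m = 420` = the ray's `s = 2`: `j₀ = 15`, `J⋆ = 23`,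
  `C_σ = 330 750 ≤ C_Π`, mass `21 414 120`), `row_frey7_l107_tower2_floors` (floors 5, 6 of the uniform 2-tower are p532255's rows `scale32`/`scale64`),
  `row_frey7_l107_tower2_neverClosed` (along ANY floor schedule the EXP-3 object at X1 never closes even the base requirement: `NeverClosedFrom _ 10 707 060 0 1`).
HONEST FRAMING: «never closes» / «short» concern the certified OBJECT CLASS fed into the barrier frame at the orbit's heights, not [IUTchIII]
Cor. 3.12 in print; the isogeny/Kummer dictionary is a modelling hypothesis recorded in the memo; a finite isogeny class over a number field is a
FINITE orbit (bounded height excursion), the towers are its formal continuation; typed ≠ proved; computed ≠ proved for the bed link (kit job of record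
in the memo). [cite: Mochizuki2012, IUTchIII Rmk. 2.1.1 (ii) p. 62, Cor. 3.12 p. 173–174; IUTchIV Prop. 1.2 p. 10] [cite: Silverman1994, IV Ex. 4.40
p. 380; V Ex. 5.10, 5.15 pp. 452–453] [claim: Mochizuki2012, status: disputed]
-/

namespace Summit.ABC.IUTFork.Repair.RH.TowerOrbit

open Finset
open Summit.ABC.IUTFork.Repair.RH.DiffPricedHull Summit.ABC.IUTFork.Repair.RH.HullCellSlice
open Summit.ABC.IUTFork.Repair.RH.HullCellSlackSum Summit.ABC.IUTFork.Repair.RH.HullCellSlackLaw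
open Summit.ABC.IUTFork.Repair.RH.HullCellSlackFinReach
open Summit.ABC.IUTFork.Repair.RH.WithinPlaceFinancingHeightLaw
open Summit.ABC.IUTFork.Repair.RH.HeightScalingBarrier

variable {k : ℕ}

/-! ## §1. Direction-free cap: at EVERY orbit point (per-place multipliers `t_i ≥ 0`) the class is under `Σ c_i·C_Π(i)` -/

/-- **THE CAP DOES NOT SEE THE DIRECTION.** Finitely many places `i : Fin k` (`0 < e_i`, `0 ≤ δ_i`, `r_out ≤ r_in`), base heights `m_i ≥ 0`,
weights `c_i ≥ 0`, and an ORBIT POINT given by per-place multipliers `t_i ≥ 0` (isogeny / Kummer tower: `t_i = N^{c_i}`; the D2 ray: `t_i = s` for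
all `i`): for any slice boundaries `J_i ≤ L`, `Σ_i c_i·Σ_{j ≤ J_i} s_j^{(i)}(t_i·m_i) ≤ Σ_i c_i·C_Π(i)` — p532824 `sum_slack_le_capPi` at the height
`t_i·m_i`, place by place. [folklore] -/
theorem towerOrbit_credit_le_cap {e δ rin rout m t : Fin k → ℤ} (he : ∀ i, 0 < e i) (hδ : ∀ i, 0 ≤ δ i)
    (hio : ∀ i, rout i ≤ rin i) (hm : ∀ i, 0 ≤ m i) (ht : ∀ i, 0 ≤ t i) {L : ℕ} {c : Fin k → ℝ} (hc : ∀ i, 0 ≤ c i)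
    {J : Fin k → ℕ} (hJ : ∀ i, J i ≤ L) :
    ∑ i, c i * ((∑ n ∈ range (J i), (((1 + (n : ℤ)) * δ i + (1 + (n : ℤ) + 1) * (rin i - rout i) +
        ((1 + (n : ℤ)) ^ 2 * (t i * m i) - (1 + (n : ℤ)) * δ i - (1 + (n : ℤ) + 1) * rin i) % e i) -
          ((1 + (n : ℤ)) ^ 2 - 1) * (t i * m i)) : ℤ) : ℝ) ≤
      ∑ i, c i * ((∑ n ∈ range L, ((1 + (n : ℤ)) * δ i + (1 + (n : ℤ) + 1) * (rin i - rout i) + (e i - 1)) : ℤ) : ℝ) := by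
  refine sum_le_sum fun i _ => mul_le_mul_of_nonneg_left ?_ (hc i)
  exact_mod_cast sum_slack_le_capPi (he i) (hδ i) (hio i) (mul_nonneg (ht i) (hm i)) (hJ i)

/-- **EXPONENT `−1` IN THE ORBIT'S OWN HEIGHT.** At an orbit point whose weighted mass `Σ_i c_i·Σ_{j ≤ L} d_j(t_i·m_i)` exceeds `Σ_i c_i·C_Π(i) + tol`,
the class's weighted credit plus the tolerance is STRICTLY short of that mass — whatever the direction `t`. (So the recovered fraction at the
orbit point is `≤ (Σ c_i C_Π(i))/(M − tol)`: the ray's constant, the ray's exponent, for every tower.) [folklore] -/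
theorem towerOrbit_credit_add_tol_lt_mass_of_lt {e δ rin rout m t : Fin k → ℤ} (he : ∀ i, 0 < e i) (hδ : ∀ i, 0 ≤ δ i)
    (hio : ∀ i, rout i ≤ rin i) (hm : ∀ i, 0 ≤ m i) (ht : ∀ i, 0 ≤ t i) {L : ℕ} {c : Fin k → ℝ} (hc : ∀ i, 0 ≤ c i)
    {J : Fin k → ℕ} (hJ : ∀ i, J i ≤ L) {tol : ℝ}
    (hlt : ∑ i, c i * ((∑ n ∈ range L, ((1 + (n : ℤ)) * δ i + (1 + (n : ℤ) + 1) * (rin i - rout i) + (e i - 1)) : ℤ) : ℝ) + tol <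
      ∑ i, c i * ((∑ n ∈ range L, (((1 + (n : ℤ)) ^ 2 - 1) * (t i * m i)) : ℤ) : ℝ)) :
    ∑ i, c i * ((∑ n ∈ range (J i), (((1 + (n : ℤ)) * δ i + (1 + (n : ℤ) + 1) * (rin i - rout i) +
        ((1 + (n : ℤ)) ^ 2 * (t i * m i) - (1 + (n : ℤ)) * δ i - (1 + (n : ℤ) + 1) * rin i) % e i) -
          ((1 + (n : ℤ)) ^ 2 - 1) * (t i * m i)) : ℤ) : ℝ) + tol <
      ∑ i, c i * ((∑ n ∈ range L, (((1 + (n : ℤ)) ^ 2 - 1) * (t i * m i)) : ℤ) : ℝ) := by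
  have h := towerOrbit_credit_le_cap he hδ hio hm ht hc hJ
  linarith

/-- **THE TOWER IN THE BARRIER'S WORDS** (p534933 `withinPlaceFinancing_family_not_closedBy` BY NAME). Index the orbit by a real parameter `s` and
let the place heights be `t_i(s)·m_i` with integer multipliers `t_i(s) ≥ 0` from `s₁` on (a tower read at floor `⌊s⌋`, a mixed μ/étale pattern, the ray
`t_i(s) = ⌊s⌋`, …) and slice boundaries `J_i(s) ≤ L`: against a requirement `M₁·s − tol` of positive slope the weighted class does not close at any
`s ≥ s₁` with `s > (Σ_i c_i·C_Π(i) + tol)/M₁`. With `M₁` the orbit's base mass and `s` the orbit point's height ratio `M/M₁`, `M₁·s` IS that point's mass.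
[folklore] -/
theorem towerOrbit_family_not_closedBy {e δ rin rout m : Fin k → ℤ} (he : ∀ i, 0 < e i) (hδ : ∀ i, 0 ≤ δ i)
    (hio : ∀ i, rout i ≤ rin i) (hm : ∀ i, 0 ≤ m i) {L : ℕ} {c : Fin k → ℝ} (hc : ∀ i, 0 ≤ c i)
    {t : Fin k → ℝ → ℤ} {J : Fin k → ℝ → ℕ} {s₁ : ℝ} (ht : ∀ i s, s₁ ≤ s → 0 ≤ t i s) (hJ : ∀ i s, s₁ ≤ s → J i s ≤ L)
    {M₁ tol s : ℝ} (hM : 0 < M₁) (hs₁ : s₁ ≤ s)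
    (hs : (∑ i, c i * ((∑ n ∈ range L, ((1 + (n : ℤ)) * δ i + (1 + (n : ℤ) + 1) * (rin i - rout i) + (e i - 1)) : ℤ) : ℝ)
        + tol) / M₁ < s) :
    ¬ ClosedBy
      (fun i (s : ℝ) => c i * ((∑ n ∈ range (J i s), (((1 + (n : ℤ)) * δ i + (1 + (n : ℤ) + 1) * (rin i - rout i) +
          ((1 + (n : ℤ)) ^ 2 * (t i s * m i) - (1 + (n : ℤ)) * δ i - (1 + (n : ℤ) + 1) * rin i) % e i) -
            ((1 + (n : ℤ)) ^ 2 - 1) * (t i s * m i)) : ℤ) : ℝ))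
      M₁ tol s :=
  withinPlaceFinancing_family_not_closedBy (μ := fun i s => t i s * m i) he hδ hio hc
    (fun i s' hs' => mul_nonneg (ht i s' hs') (hm i)) hJ hM hs₁ hs

/-- The tower family's `NeverClosedFrom` at the barrier's closed-form threshold (`α = a = 0`; p534933 `withinPlaceFinancing_family_neverClosedFrom`
BY NAME). [folklore] -/
theorem towerOrbit_family_neverClosedFrom {e δ rin rout m : Fin k → ℤ} (he : ∀ i, 0 < e i) (hδ : ∀ i, 0 ≤ δ i)
    (hio : ∀ i, rout i ≤ rin i) (hm : ∀ i, 0 ≤ m i) {L : ℕ} {c : Fin k → ℝ} (hc : ∀ i, 0 ≤ c i)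
    {t : Fin k → ℝ → ℤ} {J : Fin k → ℝ → ℕ} {s₁ : ℝ} (ht : ∀ i s, s₁ ≤ s → 0 ≤ t i s) (hJ : ∀ i s, s₁ ≤ s → J i s ≤ L)
    {M₁ : ℝ} (hM : 0 < M₁) (tol : ℝ) :
    NeverClosedFrom
      (fun i (s : ℝ) => c i * ((∑ n ∈ range (J i s), (((1 + (n : ℤ)) * δ i + (1 + (n : ℤ) + 1) * (rin i - rout i) +
          ((1 + (n : ℤ)) ^ 2 * (t i s * m i) - (1 + (n : ℤ)) * δ i - (1 + (n : ℤ) + 1) * rin i) % e i) -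
            ((1 + (n : ℤ)) ^ 2 - 1) * (t i s * m i)) : ℤ) : ℝ))
      M₁ tol
      (barrierScale M₁ tol s₁ 0 (posConstSum fun i =>
        c i * ((∑ n ∈ range L, ((1 + (n : ℤ)) * δ i + (1 + (n : ℤ) + 1) * (rin i - rout i) + (e i - 1)) : ℤ) : ℝ))) :=
  withinPlaceFinancing_family_neverClosedFrom (μ := fun i s => t i s * m i) he hδ hio hc
    (fun i s' hs' => mul_nonneg (ht i s' hs') (hm i)) hJ hM tol

/-! ## §2. The uniform (μ-type) tower `m_w ↦ N^a·m_w` is a SUB-RAY: the datum barrier at `s = N^a`, and cofinality -/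

variable {n : ℕ}

/-- **FLOOR `a` OF THE UNIFORM TOWER = THE RAY AT `s = N^a`** (p534933 `weighted_onSliceCredit_add_tol_lt_demand_of_lt` BY NAME): once
`3·Σ_w c_w·((δ_w+G_w)L(L+1) + 2G_wL + 2(e_w−1)L) + 6·tol < N^a·Σ_w c_w·m_w·L(L−1)(2L+5)`, the class's weighted total at the heights `N^a·m_w` plus `tol`
is strictly short of the demand there. [folklore] -/
theorem uniformTower_credit_add_tol_lt_demand_of_lt (e m δ rin rout : Fin n → ℤ) (c : Fin n → ℝ) (L : ℕ) (N : ℤ) (a : ℕ)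
    (J : Fin n → ℕ) (tol : ℝ)
    (he : ∀ w, 0 < e w) (hδ : ∀ w, 0 ≤ δ w) (hio : ∀ w, rout w ≤ rin w) (hm : ∀ w, 0 ≤ m w) (hN : 0 ≤ N)
    (hc : ∀ w, 0 ≤ c w) (hJ : ∀ w, J w ≤ L)
    (hlt : 3 * ∑ w, c w * (((δ w + (rin w - rout w)) * ((L : ℤ) * (L + 1)) + 2 * (rin w - rout w) * L + 2 * (e w - 1) * L : ℤ) : ℝ)
        + 6 * tol < ((N ^ a : ℤ) : ℝ) * ∑ w, c w * ((m w * ((L : ℤ) * (L - 1) * (2 * L + 5)) : ℤ) : ℝ)) :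
    ∑ w, c w * ((∑ j ∈ range (J w), (((1 + (j : ℤ)) * δ w + (1 + (j : ℤ) + 1) * (rin w - rout w) +
        ((1 + (j : ℤ)) ^ 2 * (N ^ a * m w) - (1 + (j : ℤ)) * δ w - (1 + (j : ℤ) + 1) * rin w) % e w) -
          ((1 + (j : ℤ)) ^ 2 - 1) * (N ^ a * m w)) : ℤ) : ℝ) + tol <
      ∑ w, c w * ((∑ j ∈ range L, (((1 + (j : ℤ)) ^ 2 - 1) * (N ^ a * m w)) : ℤ) : ℝ) :=
  weighted_onSliceCredit_add_tol_lt_demand_of_lt e m δ rin rout c L (N ^ a) J tol he hδ hio hm (pow_nonneg hN a) hc hJ hlt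

/-- **THE TOWER IS COFINAL IN THE RAY**: `N ≥ 2` and a positive demand slope `Σ_w c_w·m_w·L(L−1)(2L+5) > 0` ⇒ there is a floor `a₀` such that at
EVERY floor `a ≥ a₀` (heights `N^a·m_w`, any slice boundaries `J_w ≤ L`) the class plus `tol` is strictly short of the demand — the orbit of a μ-type
tower runs into the barrier exactly as the ray does («KILLED-BY-CONSISTENCY» for census row O-08). [folklore] -/
theorem uniformTower_eventually_short (e m δ rin rout : Fin n → ℤ) (c : Fin n → ℝ) (L : ℕ) (N : ℤ) (tol : ℝ)
    (he : ∀ w, 0 < e w) (hδ : ∀ w, 0 ≤ δ w) (hio : ∀ w, rout w ≤ rin w) (hm : ∀ w, 0 ≤ m w) (hN : 2 ≤ N)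
    (hc : ∀ w, 0 ≤ c w) (hpos : 0 < ∑ w, c w * ((m w * ((L : ℤ) * (L - 1) * (2 * L + 5)) : ℤ) : ℝ)) :
    ∃ a₀ : ℕ, ∀ a : ℕ, a₀ ≤ a → ∀ J : Fin n → ℕ, (∀ w, J w ≤ L) →
      ∑ w, c w * ((∑ j ∈ range (J w), (((1 + (j : ℤ)) * δ w + (1 + (j : ℤ) + 1) * (rin w - rout w) +
          ((1 + (j : ℤ)) ^ 2 * (N ^ a * m w) - (1 + (j : ℤ)) * δ w - (1 + (j : ℤ) + 1) * rin w) % e w) -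
            ((1 + (j : ℤ)) ^ 2 - 1) * (N ^ a * m w)) : ℤ) : ℝ) + tol <
        ∑ w, c w * ((∑ j ∈ range L, (((1 + (j : ℤ)) ^ 2 - 1) * (N ^ a * m w)) : ℤ) : ℝ) := by
  set D : ℝ := ∑ w, c w * ((m w * ((L : ℤ) * (L - 1) * (2 * L + 5)) : ℤ) : ℝ) with hD
  set A : ℝ := 3 * ∑ w, c w * (((δ w + (rin w - rout w)) * ((L : ℤ) * (L + 1)) + 2 * (rin w - rout w) * L +
    2 * (e w - 1) * L : ℤ) : ℝ) + 6 * tol with hA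
  have hN1 : (1 : ℝ) < (N : ℝ) := by exact_mod_cast (show (1 : ℤ) < N by linarith)
  obtain ⟨a₀, ha₀⟩ := pow_unbounded_of_one_lt (A / D) hN1
  refine ⟨a₀, fun a ha J hJ => ?_⟩
  have hpow : (N : ℝ) ^ a₀ ≤ (N : ℝ) ^ a := pow_le_pow_right₀ hN1.le ha
  have hlt' : A / D < (N : ℝ) ^ a := lt_of_lt_of_le ha₀ hpow
  have hlt : A < ((N ^ a : ℤ) : ℝ) * D := by
    rw [div_lt_iff₀ hpos] at hlt'
    push_cast
    exact hlt'
  exact uniformTower_credit_add_tol_lt_demand_of_lt e m δ rin rout c L N a J tol he hδ hio hm (by linarith) hc hJ hlt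

/-! ## §3. The exact law at an orbit point above onset: two m′-free constants (exponent `−1` exactly, any direction) -/

/-- **TWO-SIDED LAW AT AN ORBIT POINT.** If at the orbit point every place is above its financing-collapse height (`3δ_i + 5G_i + 2(e_i−1) < 3m′_i`,
`L ≥ 2`), then the weighted mass the class recovers, `Σ_i c_i·min(C_σ, R)_i(m′_i)`, lies between the two m′-FREE constants `Σ_i c_i(δ_i + 2G_i)` and
`Σ_i c_i(δ_i + 2G_i + e_i − 1)` (p532255 `within_place_financing_height_law` at `m′_i`, place by place) — while the orbit point's mass is linear in the
`m′_i`: exponent `−1` EXACTLY in the orbit's own height, for every direction of the tower. [folklore] -/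
theorem towerOrbit_financedMass_bracket {e δ rin rout m' : Fin k → ℤ} (he : ∀ i, 0 < e i) (hδ : ∀ i, 0 ≤ δ i)
    (hio : ∀ i, rout i ≤ rin i) {L : ℕ} (hL : 2 ≤ L) {c : Fin k → ℝ} (hc : ∀ i, 0 ≤ c i)
    (hon : ∀ i, 3 * δ i + 5 * (rin i - rout i) + 2 * (e i - 1) < 3 * m' i) :
    ∑ i, c i * ((δ i + 2 * (rin i - rout i) : ℤ) : ℝ) ≤
        ∑ i, c i * ((min ((((1 : ℤ) * δ i + (1 + 1) * (rin i - rout i) + ((1 : ℤ) ^ 2 * m' i - 1 * δ i - (1 + 1) * rin i) % e i) -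
            ((1 : ℤ) ^ 2 - 1) * m' i))
          ((((1 : ℤ) * δ i + (1 + 1) * (rin i - rout i) + ((1 : ℤ) ^ 2 * m' i - 1 * δ i - (1 + 1) * rin i) % e i) -
            ((1 : ℤ) ^ 2 - 1) * m' i) -
            ∑ n ∈ range L, (((1 + (n : ℤ)) * δ i + (1 + (n : ℤ) + 1) * (rin i - rout i) +
              ((1 + (n : ℤ)) ^ 2 * m' i - (1 + (n : ℤ)) * δ i - (1 + (n : ℤ) + 1) * rin i) % e i) -
                ((1 + (n : ℤ)) ^ 2 - 1) * m' i)) : ℤ) : ℝ) ∧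
      ∑ i, c i * ((min ((((1 : ℤ) * δ i + (1 + 1) * (rin i - rout i) + ((1 : ℤ) ^ 2 * m' i - 1 * δ i - (1 + 1) * rin i) % e i) -
            ((1 : ℤ) ^ 2 - 1) * m' i))
          ((((1 : ℤ) * δ i + (1 + 1) * (rin i - rout i) + ((1 : ℤ) ^ 2 * m' i - 1 * δ i - (1 + 1) * rin i) % e i) -
            ((1 : ℤ) ^ 2 - 1) * m' i) -
            ∑ n ∈ range L, (((1 + (n : ℤ)) * δ i + (1 + (n : ℤ) + 1) * (rin i - rout i) +
              ((1 + (n : ℤ)) ^ 2 * m' i - (1 + (n : ℤ)) * δ i - (1 + (n : ℤ) + 1) * rin i) % e i) -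
                ((1 + (n : ℤ)) ^ 2 - 1) * m' i)) : ℤ) : ℝ) ≤
        ∑ i, c i * ((δ i + 2 * (rin i - rout i) + (e i - 1) : ℤ) : ℝ) := by
  constructor
  · refine sum_le_sum fun i _ => mul_le_mul_of_nonneg_left ?_ (hc i)
    exact_mod_cast (within_place_financing_height_law (he i) (hδ i) (hio i) (hon i) hL).1
  · refine sum_le_sum fun i _ => mul_le_mul_of_nonneg_left ?_ (hc i)
    exact_mod_cast (within_place_financing_height_law (he i) (hδ i) (hio i) (hon i) hL).2

/-- **A μ-TYPE TOWER PASSES EVERY ONSET**: `N ≥ 2`, `m ≥ 1` ⇒ from some floor `a₀` on, `3δ + 5G + 2(e−1) < 3·(N^a·m)` — so §3's two-sided law holds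
at every sufficiently high floor of the tower at that place (for a finite set of places take the largest `a₀`). [folklore] -/
theorem muTower_eventually_above_onset (e δ rin rout : ℤ) {m N : ℤ} (hm : 1 ≤ m) (hN : 2 ≤ N) :
    ∃ a₀ : ℕ, ∀ a : ℕ, a₀ ≤ a → 3 * δ + 5 * (rin - rout) + 2 * (e - 1) < 3 * (N ^ a * m) := by
  obtain ⟨a₀, ha₀⟩ := pow_unbounded_of_one_lt (3 * δ + 5 * (rin - rout) + 2 * (e - 1)) (show (1 : ℤ) < N by linarith)
  refine ⟨a₀, fun a ha => ?_⟩
  have hpow : N ^ a₀ ≤ N ^ a := pow_le_pow_right₀ (by linarith) ha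
  have hNa : 0 ≤ N ^ a := pow_nonneg (by linarith) a
  have h1 : N ^ a ≤ N ^ a * m := le_mul_of_one_le_right hNa hm
  nlinarith

/-! ## §4. The field-tower (root-extraction) reading: uniform rescaling of the place integers — the fraction is INVARIANT -/

/-- **THE SLACK SCALES EXACTLY** under `(e, m, δ, r_in, r_out) ↦ λ·(e, m, δ, r_in, r_out)`, `λ > 0` (the residue scales: `(λX) mod (λe) = λ·(X mod e)`):
`s_j(λ·data) = λ·s_j(data)`. Together with abc-iut-rh3-gen-5's `ReqsideShellProfile.hullCellδ_scale` (the cell, hence the slice, is invariant) and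
`d_j(λm) = λ·d_j(m)`: every place total of the typed currency scales by `λ`. [folklore] -/
theorem cellSlack_scale {t : ℤ} (ht : 0 < t) (e m j δ rin rout : ℤ) :
    (j * (t * δ) + (j + 1) * (t * rin - t * rout) + (j ^ 2 * (t * m) - j * (t * δ) - (j + 1) * (t * rin)) % (t * e)) -
        (j ^ 2 - 1) * (t * m) =
      t * ((j * δ + (j + 1) * (rin - rout) + (j ^ 2 * m - j * δ - (j + 1) * rin) % e) - (j ^ 2 - 1) * m) := by
  have hX : j ^ 2 * (t * m) - j * (t * δ) - (j + 1) * (t * rin) = t * (j ^ 2 * m - j * δ - (j + 1) * rin) := by ring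
  rw [hX, Int.mul_emod_mul_of_pos _ _ ht]
  ring

/-- The cell is invariant under the rescaling — abc-iut-rh3-gen-5's `hullCellδ_scale` BY NAME, recorded here in the orbit file's words: a
totally ramified field tower does not move the slice. [folklore] -/
theorem hullCellδ_scale_iff {t : ℤ} (ht : 0 < t) (e m j δ rin rout : ℤ) :
    HullCellδ (t * e) (t * m) j (t * δ) (t * rin) (t * rout) ↔ HullCellδ e m j δ rin rout :=
  ReqsideShellProfile.hullCellδ_scale ht

/-- **Cumulative slacks scale**: `Σ_{j ≤ J} s_j(λ·data) = λ·Σ_{j ≤ J} s_j(data)` (labels `j = 1 + n`). [folklore] -/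
theorem sum_cellSlack_scale {t : ℤ} (ht : 0 < t) (e m δ rin rout : ℤ) (J : ℕ) :
    ∑ n ∈ range J, (((1 + (n : ℤ)) * (t * δ) + (1 + (n : ℤ) + 1) * (t * rin - t * rout) +
        ((1 + (n : ℤ)) ^ 2 * (t * m) - (1 + (n : ℤ)) * (t * δ) - (1 + (n : ℤ) + 1) * (t * rin)) % (t * e)) -
          ((1 + (n : ℤ)) ^ 2 - 1) * (t * m)) =
      t * ∑ n ∈ range J, (((1 + (n : ℤ)) * δ + (1 + (n : ℤ) + 1) * (rin - rout) +
        ((1 + (n : ℤ)) ^ 2 * m - (1 + (n : ℤ)) * δ - (1 + (n : ℤ) + 1) * rin) % e) - ((1 + (n : ℤ)) ^ 2 - 1) * m) := by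
  rw [mul_sum]
  exact sum_congr rfl fun n _ => cellSlack_scale ht e m (1 + (n : ℤ)) δ rin rout

/-- **THE FINANCED MASS SCALES, SO THE FRACTION IS INVARIANT**: the EXP-3 quantity `min(s_1, s_1 − Σ_{j ≤ L} s_j)` (p532255's spelling of `min(C_σ, R)`
above the slice collapse) at the rescaled place equals `λ` times its value at the place; since the place mass `Σ d_j` also scales by `λ`, every recovered
FRACTION of the typed currency is unchanged along a field tower — exponent `0` in the degree `λ`, at FIXED curve height (census row O-06's variable,
not a height move). [folklore] -/
theorem financedMass_scale {t : ℤ} (ht : 0 < t) (e m δ rin rout : ℤ) (L : ℕ) :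
    min ((((1 : ℤ) * (t * δ) + (1 + 1) * (t * rin - t * rout) + ((1 : ℤ) ^ 2 * (t * m) - 1 * (t * δ) - (1 + 1) * (t * rin)) % (t * e)) -
          ((1 : ℤ) ^ 2 - 1) * (t * m)))
        ((((1 : ℤ) * (t * δ) + (1 + 1) * (t * rin - t * rout) + ((1 : ℤ) ^ 2 * (t * m) - 1 * (t * δ) - (1 + 1) * (t * rin)) % (t * e)) -
          ((1 : ℤ) ^ 2 - 1) * (t * m)) -
          ∑ n ∈ range L, (((1 + (n : ℤ)) * (t * δ) + (1 + (n : ℤ) + 1) * (t * rin - t * rout) +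
            ((1 + (n : ℤ)) ^ 2 * (t * m) - (1 + (n : ℤ)) * (t * δ) - (1 + (n : ℤ) + 1) * (t * rin)) % (t * e)) -
              ((1 + (n : ℤ)) ^ 2 - 1) * (t * m))) =
      t * min ((((1 : ℤ) * δ + (1 + 1) * (rin - rout) + ((1 : ℤ) ^ 2 * m - 1 * δ - (1 + 1) * rin) % e) - ((1 : ℤ) ^ 2 - 1) * m))
        ((((1 : ℤ) * δ + (1 + 1) * (rin - rout) + ((1 : ℤ) ^ 2 * m - 1 * δ - (1 + 1) * rin) % e) - ((1 : ℤ) ^ 2 - 1) * m) -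
          ∑ n ∈ range L, (((1 + (n : ℤ)) * δ + (1 + (n : ℤ) + 1) * (rin - rout) +
            ((1 + (n : ℤ)) ^ 2 * m - (1 + (n : ℤ)) * δ - (1 + (n : ℤ) + 1) * rin) % e) - ((1 + (n : ℤ)) ^ 2 - 1) * m)) := by
  rw [cellSlack_scale ht e m 1 δ rin rout, sum_cellSlack_scale ht e m δ rin rout L, ← mul_sub, mul_min_of_nonneg _ _ ht.le]

/-- **The different's tame bonus only raises slacks, by an m-free amount**: the slack `s_j = m − (e·⌊(j²m − jδ − (j+1)r_in)/e⌋ + (j+1)r_out)`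
(floor form, p484618 `margin_eq_price_sub_demand`) is NON-DECREASING in `δ` for `j ≥ 0`, `e > 0` — so replacing `λδ` by the tame different
`λδ + (λ−1)` of a degree-`λ` totally ramified step can only add credit, and by p532824's cap at most `Σ_j j·(λ−1)` per place, height-free. [folklore] -/
theorem cellSlack_mono_delta {e m j δ δ' rin rout : ℤ} (he : 0 < e) (hj : 0 ≤ j) (hδ : δ ≤ δ') :
    m - (e * ((j ^ 2 * m - j * δ - (j + 1) * rin) / e) + (j + 1) * rout) ≤
      m - (e * ((j ^ 2 * m - j * δ' - (j + 1) * rin) / e) + (j + 1) * rout) := by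
  have h1 : j ^ 2 * m - j * δ' - (j + 1) * rin ≤ j ^ 2 * m - j * δ - (j + 1) * rin := by nlinarith
  have h2 : (j ^ 2 * m - j * δ' - (j + 1) * rin) / e ≤ (j ^ 2 * m - j * δ - (j + 1) * rin) / e := Int.ediv_le_ediv he h1
  nlinarith

/-! ## §5. Worked orbit X1 (FREY `p = 7`, `l = 107`): the genuine 2-isogeny orbit and the uniform 2-tower at the place -/

/-- **HALVED POINT `m = 105`** (the curves `E/K_a`, `E/K_b`: `ord_7(q)` halves since `7 ∣ c`): EVERY label `1 ≤ j ≤ 53` is licensed (the whole place is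
in the slice; nothing is left to finance), the on-slice credit is `Σ_{j ≤ 53} s_j(105) = 4 022 653 ≤ C_Π = 9 414 496`, and the place mass is
`105·S(53) = 5 353 530` — below the place's own price total: the halved point sits deeper in the content-free regime. [folklore] -/
theorem row_frey7_l107_isog2_halved :
    (∀ j ∈ Icc (1 : ℤ) 53, HullCellδ 1605 105 j 1604 268 (-4472)) ∧
      ∑ k ∈ range 53, (((1 + (k : ℤ)) * 1604 + (1 + (k : ℤ) + 1) * (268 - (-4472)) +
          ((1 + (k : ℤ)) ^ 2 * 105 - (1 + (k : ℤ)) * 1604 - (1 + (k : ℤ) + 1) * 268) % 1605) - ((1 + (k : ℤ)) ^ 2 - 1) * 105)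
        = 4022653 ∧
      (4022653 : ℤ) ≤ 9414496 ∧ (105 : ℤ) * 50986 = 5353530 ∧ (2 : ℤ) * 105 = 210 := by
  refine ⟨?_, by decide, by norm_num, by norm_num, by norm_num⟩
  unfold HullCellδ
  decide

/-- **DOUBLED POINT `m = 420`** (the curve `E/K_c`; the same heights as the ray's `s = 2`): slice boundary `j₀ = 15` (cell IN at `15`, OFF at `16`),
on-slice credit `C_σ = Σ_{j ≤ 15} s_j(420) = 330 750 ≤ C_Π = 9 414 496`, financed reach `J⋆ = 23` (cumulative slack `≥ 0` through `23`, `< 0` at `24`),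
place mass `420·S(53) = 21 414 120` (twice the base `10 707 060`). [folklore] -/
theorem row_frey7_l107_isog2_doubled :
    HullCellδ 1605 420 15 1604 268 (-4472) ∧ ¬ HullCellδ 1605 420 16 1604 268 (-4472) ∧
      ∑ k ∈ range 15, (((1 + (k : ℤ)) * 1604 + (1 + (k : ℤ) + 1) * (268 - (-4472)) +
          ((1 + (k : ℤ)) ^ 2 * 420 - (1 + (k : ℤ)) * 1604 - (1 + (k : ℤ) + 1) * 268) % 1605) - ((1 + (k : ℤ)) ^ 2 - 1) * 420)
        = 330750 ∧
      (0 : ℤ) ≤ ∑ k ∈ range 23, (((1 + (k : ℤ)) * 1604 + (1 + (k : ℤ) + 1) * (268 - (-4472)) +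
          ((1 + (k : ℤ)) ^ 2 * 420 - (1 + (k : ℤ)) * 1604 - (1 + (k : ℤ) + 1) * 268) % 1605) - ((1 + (k : ℤ)) ^ 2 - 1) * 420) ∧
      ∑ k ∈ range 24, (((1 + (k : ℤ)) * 1604 + (1 + (k : ℤ) + 1) * (268 - (-4472)) +
          ((1 + (k : ℤ)) ^ 2 * 420 - (1 + (k : ℤ)) * 1604 - (1 + (k : ℤ) + 1) * 268) % 1605) - ((1 + (k : ℤ)) ^ 2 - 1) * 420) < 0 ∧
      (330750 : ℤ) ≤ 9414496 ∧ (420 : ℤ) * 50986 = 21414120 ∧ (2 : ℤ) * 210 = 420 := by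
  refine ⟨?_, ?_, by decide, by decide, by decide, by norm_num, by norm_num, by norm_num⟩
  · unfold HullCellδ; decide
  · unfold HullCellδ; decide

/-- **FLOORS 5 AND 6 OF THE UNIFORM 2-TOWER ARE p532255's ROWS**: `210·2^5 = 6720` (`row_frey7_l107_scale32`: `j₀ = 1`, `J⋆ = 2`) and `210·2^6 = 13440`
(`row_frey7_l107_scale64`: `s_1 = 11149 ∈ [11084, 12688]`, `J⋆ = 1`, the law instantiated) — the tower's orbit at this place IS the ray's `s = 32, 64`.
[folklore] -/
theorem row_frey7_l107_tower2_floors :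
    (210 : ℤ) * 2 ^ 5 = 6720 ∧ (210 : ℤ) * 2 ^ 6 = 13440 ∧
      HullCellδ 1605 (210 * 2 ^ 5) 1 1604 268 (-4472) ∧ ¬ HullCellδ 1605 (210 * 2 ^ 5) 2 1604 268 (-4472) ∧
      3 * (1604 : ℤ) + 5 * (268 - (-4472)) + 2 * (1605 - 1) < 3 * (210 * 2 ^ 6) := by
  refine ⟨by norm_num, by norm_num, ?_, ?_, by norm_num⟩
  · rw [show (210 : ℤ) * 2 ^ 5 = 6720 by norm_num]; exact row_frey7_l107_scale32.1
  · rw [show (210 : ℤ) * 2 ^ 5 = 6720 by norm_num]; exact row_frey7_l107_scale32.2.1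

/-- **AT X1 NO FLOOR SCHEDULE OF THE 2-TOWER LETS EXP-3 CLOSE EVEN THE BASE REQUIREMENT** (`closedBy_mono` + `frey7_l107_envelope_neverClosed`
BY NAME): with the place height read at ANY floor `a(s)` (`m = 210·2^{a(s)}`) and any slice boundary `J(s) ≤ 53`, the one-object family satisfies
`NeverClosedFrom _ 10 707 060 0 1` — the credit is `≤ 9 414 496 < 10 707 060 ≤ 10 707 060·s` at every `s ≥ 1` (p534933 `row_frey7_l107_onSliceCredit_le_envelope`
at the height `2^{a(s)}`). [folklore] -/
theorem row_frey7_l107_tower2_neverClosed {J : ℝ → ℕ} (hJ : ∀ s, J s ≤ 53) (a : ℝ → ℕ) :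
    NeverClosedFrom
      (fun (_ : Fin 1) (s : ℝ) => ((∑ k ∈ range (J s), (((1 + (k : ℤ)) * 1604 + (1 + (k : ℤ) + 1) * (268 - (-4472)) +
        ((1 + (k : ℤ)) ^ 2 * (210 * 2 ^ (a s)) - (1 + (k : ℤ)) * 1604 - (1 + (k : ℤ) + 1) * 268) % 1605) -
          ((1 + (k : ℤ)) ^ 2 - 1) * (210 * 2 ^ (a s))) : ℤ) : ℝ))
      10707060 0 1 := by
  intro s hs h
  refine frey7_l107_envelope_neverClosed s hs (closedBy_mono (suppliedMass_mono fun i => ?_) h)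
  have hle := row_frey7_l107_onSliceCredit_le_envelope (2 ^ (a s)) (pow_nonneg (by norm_num) _) (hJ s)
  simp only [frey7_l107_envelope]
  exact_mod_cast hle

end Summit.ABC.IUTFork.Repair.RH.TowerOrbit
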